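import Mathlib.Analysis.Complex.Polynomial.Basic
import Literature.NumberTheory.Transcendental.ProjectiveSpace
import HarnessLib

/-!
# A projective hypersurface over `ℂ` is non-empty

Layer `Literature/NumberTheory/Transcendental` (next to `ProjectiveSpace`, whose projective zero
loci `Projectivization.projZeroLocus` it concerns). We PROVE that the zero locus in `ℙ ℂ ℂ^{n+2}`
(at least two homogeneous coordinates) of one homogeneous polynomial `F` of positive degree is
non-empty (`Projectivization.projZeroLocus_singleton_nonempty`): restrict `F` to the line
`t ↦ [t : 1 : 0 : ⋯ : 0]`; the resulting univariate polynomial has a root by the fundamental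
theorem of algebra (Mathlib `Complex.exists_root`) unless it is a constant `c`, in which case
homogeneity gives `F(1, s, 0, …, 0) = c s^d → 0` as `s → 0`, so `[1 : 0 : ⋯ : 0]` is a zero.
This is the elementary case of the projective dimension theorem (Hartshorne I Thm. 7.2:
hypersurfaces in `ℙⁿ`, `n ≥ 1`, are non-empty), used by the residue-form programme of
`Literature/AlgebraicGeometry/HodgeTheory/HypersurfaceResidueForms` (non-emptiness of a smooth
hypersurface's holomorphic model).

## References

* R. Hartshorne, *Algebraic Geometry* (1977), I Thm. 7.2 and Ex. 1.8.
-/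

noncomputable section

open scoped LinearAlgebra.Projectivization Topology
open Set Filter Polynomial

namespace Literature.NumberTheory.Transcendental

variable {n : ℕ}

/-- The punctual line `t ↦ (t, 1, 0, …, 0)` in `ℂ^{n+2}`. [folklore] -/
def coordLineVec (t : ℂ) : Fin (n + 2) → ℂ := Fin.cons t (Fin.cons 1 0)

/-- The points of `coordLineVec` are non-zero (second coordinate `1`). [folklore] -/
theorem coordLineVec_ne_zero (t : ℂ) : (coordLineVec t : Fin (n + 2) → ℂ) ≠ 0 := by
  intro h
  have := congrFun h 1
  simp [coordLineVec] at this

/-- The substitution `X₀ ↦ T`, `X₁ ↦ 1`, `X_k ↦ 0` (`k ≥ 2`) into univariate polynomials.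
[folklore] -/
def coordLineSubst : Fin (n + 2) → ℂ[X] := Fin.cons Polynomial.X (Fin.cons 1 0)

/-- Evaluating the restricted polynomial at `t` is evaluating `F` at `coordLineVec t`
(`MvPolynomial.comp_aeval_apply`). [folklore] -/
theorem eval_aeval_coordLineSubst (F : MvPolynomial (Fin (n + 2)) ℂ) (t : ℂ) :
    (MvPolynomial.aeval coordLineSubst F).eval t = MvPolynomial.eval (coordLineVec t) F := by
  have h' := MvPolynomial.comp_aeval_apply (f := coordLineSubst (n := n))
    (Polynomial.aeval t : ℂ[X] →ₐ[ℂ] ℂ) F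
  simp only [Polynomial.coe_aeval_eq_eval] at h'
  rw [h']
  change MvPolynomial.eval (fun i ↦ eval t (coordLineSubst i)) F = _
  congr 2
  funext k
  refine Fin.cases ?_ (fun k' ↦ Fin.cases ?_ (fun j ↦ ?_) k') k <;> simp [coordLineSubst, coordLineVec]

/-- **A projective hypersurface over `ℂ` is non-empty**: for `F ∈ ℂ[X₀, …, X_{n+1}]` homogeneous
of positive degree `d`, the projective zero locus `{[z] | F(z) = 0} ⊂ ℙ ℂ ℂ^{n+2}` is non-empty.
Proof: on the line `[t : 1 : 0 : ⋯ : 0]` the polynomial `F(t, 1, 0, …)` has a complex root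
(`Complex.exists_root`) unless it is a constant `c`; then `F(1, s, 0, …) = s^d F(s⁻¹, 1, 0, …) = c s^d`
for `s ≠ 0` (`Projectivization.eval_smul_of_isHomogeneous`), and letting `s → 0`,
`F(1, 0, …, 0) = 0`. (Hartshorne I Thm. 7.2 / Ex. 1.8 in the simplest case; a dot-notation
extension of the tree's `Projectivization.projZeroLocus` API.) [cite: Hartshorne1977, I Thm. 7.2] -/
theorem _root_.Projectivization.projZeroLocus_singleton_nonempty (F : MvPolynomial (Fin (n + 2)) ℂ)
    {d : ℕ} (hF : F.IsHomogeneous d) (hd : 0 < d) :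
    (Projectivization.projZeroLocus {F}).Nonempty := by
  by_cases hF0 : F = 0
  · refine ⟨Projectivization.mk ℂ (coordLineVec 0) (coordLineVec_ne_zero 0), ?_⟩
    subst hF0; simp [Projectivization.projZeroLocus]
  have hS : ∀ G ∈ ({F} : Set (MvPolynomial (Fin (n + 2)) ℂ)), G.IsHomogeneous G.totalDegree := by
    rintro G rfl; rwa [hF.totalDegree hF0]
  -- it suffices to find a non-zero zero of `F`
  suffices h : ∃ v : Fin (n + 2) → ℂ, ∃ hv : v ≠ 0, MvPolynomial.eval v F = 0 by
    obtain ⟨v, hv, h0⟩ := h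
    exact ⟨Projectivization.mk ℂ v hv,
      (Projectivization.mem_projZeroLocus_mk_iff hS v hv).mpr (by simpa using h0)⟩
  set p : ℂ[X] := MvPolynomial.aeval coordLineSubst F with hp
  by_cases hdeg : 0 < p.degree
  · obtain ⟨t, ht⟩ := Complex.exists_root hdeg
    exact ⟨coordLineVec t, coordLineVec_ne_zero t, by rw [← eval_aeval_coordLineSubst]; exact ht⟩
  · -- `p = C c`: `F(t, 1, 0, …) = c` for all `t`, hence `F(1, s, 0, …) = c s^d` and `F(e₀) = 0`
    have hpc : p = Polynomial.C (p.coeff 0) := Polynomial.eq_C_of_degree_le_zero (not_lt.mp hdeg)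
    set c := p.coeff 0 with hc
    have hval : ∀ t : ℂ, MvPolynomial.eval (coordLineVec t) F = c := fun t ↦ by
      rw [← eval_aeval_coordLineSubst, ← hp, hpc, Polynomial.eval_C]
    set e₀ : Fin (n + 2) → ℂ := Fin.cons 1 0 with he₀
    have he₀0 : e₀ ≠ 0 := by intro h; have := congrFun h 0; simp [he₀] at this
    refine ⟨e₀, he₀0, ?_⟩
    have hscale : ∀ s : ℂ, s ≠ 0 →
        MvPolynomial.eval (Fin.cons 1 (Fin.cons s 0) : Fin (n + 2) → ℂ) F = s ^ d * c := by
      intro s hs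
      have : (Fin.cons 1 (Fin.cons s 0) : Fin (n + 2) → ℂ) = s • coordLineVec s⁻¹ := by
        funext k
        refine Fin.cases ?_ (fun k' ↦ Fin.cases ?_ (fun j ↦ ?_) k') k <;> simp [coordLineVec, hs]
      rw [this, Projectivization.eval_smul_of_isHomogeneous hF, hval]
    -- continuity at `s = 0`
    have hcont : Continuous fun s : ℂ ↦
        MvPolynomial.eval (Fin.cons 1 (Fin.cons s 0) : Fin (n + 2) → ℂ) F := by
      refine (MvPolynomial.continuous_eval F).comp (continuous_pi fun k ↦ ?_)
      refine Fin.cases ?_ (fun k' ↦ Fin.cases ?_ (fun j ↦ ?_) k') k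
      · simpa using continuous_const
      · simp only [Fin.cons_succ, Fin.cons_zero]; exact continuous_id
      · simpa using continuous_const
    have he₀' : e₀ = (Fin.cons 1 (Fin.cons 0 0) : Fin (n + 2) → ℂ) := by
      rw [he₀]; congr 1; funext k; refine Fin.cases ?_ (fun j ↦ ?_) k <;> simp
    have h1 : Tendsto (fun s : ℂ ↦ MvPolynomial.eval (Fin.cons 1 (Fin.cons s 0) : Fin (n + 2) → ℂ) F)
        (𝓝[≠] 0) (𝓝 (MvPolynomial.eval e₀ F)) := by
      have := hcont.continuousAt (x := 0) |>.tendsto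
      rw [he₀']
      exact this.mono_left nhdsWithin_le_nhds
    have h2 : Tendsto (fun s : ℂ ↦ MvPolynomial.eval (Fin.cons 1 (Fin.cons s 0) : Fin (n + 2) → ℂ) F)
        (𝓝[≠] 0) (𝓝 0) := by
      have h3 : Tendsto (fun s : ℂ ↦ s ^ d * c) (𝓝[≠] 0) (𝓝 0) := by
        have : Tendsto (fun s : ℂ ↦ s ^ d * c) (𝓝 0) (𝓝 (0 ^ d * c)) :=
          ((continuous_pow d).mul continuous_const).continuousAt.tendsto
        rw [zero_pow hd.ne', zero_mul] at this
        exact this.mono_left nhdsWithin_le_nhds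
      refine h3.congr' ?_
      filter_upwards [self_mem_nhdsWithin] with s hs
      exact (hscale s hs).symm
    exact tendsto_nhds_unique h1 h2

end Literature.NumberTheory.Transcendental

end
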